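import Summits.AnomalousDissipation.AnomalousDissipation.Theorems.SolenoidalFractalHomogenisationLagrangianStepCellLawVEffectiveGenerator
import Summits.AnomalousDissipation.AnomalousDissipation.Theorems.SolenoidalFractalHomogenisationLagrangianStepCellCorrectorContent
import Literature.Analysis.FluidPDE.PassiveVectorTensorFourier
import HarnessLib

/-!
# K1L `LagrangianRenormalisationStep(Design)` (K1L_D, stmt-AnomalousDissipation-27980; aside 24912), stub `stub_cellLawV0_IS`
# — THE EXPLICIT SLOW MODE OF THE EFFECTIVE (carrier-free, constant-tensor) SOLUTION: `modeCoeff ℓ (v t) = e^{−t Ḡ} (p/2)`,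
# `Ḡ = effGen 𝔹 ℓ = 4π² P_ℓ Σ(𝔹, ℓ) P_ℓ` (helper; `--supports stmt-AnomalousDissipation-27980`; word-independent; part 2 of 2)

Summits-side helper file of route `SolenoidalFractalHomogenisation` (planner ad-ideate-p5's STUB-PLAN for `stub_cellLawV` §1 (V) steps V0/V2/V6), on top of
`…CellLawVEffectiveGenerator` (part 1), `…CellCorrectorContent` (p634914, `modeCoeff_eq`) and ad-lit's `PassiveVectorTensorFourier` (modewise integral identity
`IsWeakTensorPassiveVectorOn.ae_inner_mFourierCoeff_eq`).  In clause (V) = `SlowVectorClauseNoExF` the cell solution is compared on the slow pair `±ℓ`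
(`…CellLawVSectorReduction`, p645135) with THE weak solution `v` of `∂ₜv = 𝓛_𝔹 v + ∇π`, `∇·v = 0`, NO carrier, from `Re e_ℓ·p`:
* `mFourierCoeff_singleMode_self` — `𝓕(Re e_ℓ·p)(ℓ) = ½·p` (`ℓ ≠ 0`); `testVec`, `re_inner_testVec` / `im_inner_testVec` / `symbT_testVec` — pairing with
  complexified real test vectors;
* `effective_mode_identity_re_im` — the modewise identity tested against a real transversal `q`, real and imaginary parts (the carrier terms vanish,
  `integral_re` / `integral_im`); `effective_mode_transversal` — `Σ ℓⱼ Re/Im 𝓕(v τ)(ℓ)ⱼ = 0` a.e. (`IsWeaklyDivFree.sum_mul_mFourierCoeff_eq_zero`);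
* **`effective_mFourierCoeff_eq` / `effective_modeCoeff_eq`** — for EVERY constant tensor `𝔹` (no ellipticity needed), `ℓ ≠ 0`, `p ⊥ ℓ`, every weak
  solution `v` and a.e. `t ∈ (0,T')`: `𝓕(v t)(ℓ)ⱼ = ((e^{−tḠ}(p/2))ⱼ : ℂ)`, `modeCoeff ℓ (v t) j` likewise (real parts solve `X = p/2 − ∫Ḡ X`, imaginary
  parts `Y = −∫ ḠY`, by part 1).  With `…CellLawVSectorReduction` this turns (V) into an estimate on `modeCoeff ℓ (w t)` alone against the explicit
  `e^{−tḠ}(p/2)` — the shape of ad-lit's `sum_sq_sub_exp_mulVec_le_of_apriori` (`LinearPeriodicAveraging`, V5).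
No named facts, no sorry.  Infrastructure for route-1's rung leaf F-D1.A0 (frontier FORMAL rung); NOT a proof of the stub, of the crux, of Onsager's
conjecture or of anomalous dissipation.  Prover seat `ad-k1l-cellLawV-w1` g0, 2026-08-28.
-/

set_option linter.dupNamespace false

noncomputable section

namespace Summit.AnomalousDissipation.AnomalousDissipation.Theorems.SolenoidalFractalHomogenisation.LagrangianStep

open Literature.Analysis Literature.Analysis.FluidPDE Literature.Analysis.FunctionSpaces
open Literature.Analysis.ODE.PeriodicAveraging
open MeasureTheory Set Filter Function UnitAddTorus
open scoped ENNReal NNReal InnerProductSpace Topology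

/-! ## §3 The slow mode of the effective solution -/

section Effective

variable {𝔹 : Torus.Visc4 (Fin 3)} {ℓ : Fin 3 → ℤ} {p : EuclideanSpace ℝ (Fin 3)} {T' : ℝ} {v : ℝ → VF}

/-- The Fourier coefficient of the single-mode datum at its own frequency: `𝓕(Re e_ℓ·p)(ℓ) = ½·p` (`ℓ ≠ 0`). [folklore] -/
theorem mFourierCoeff_singleMode_self (hℓ : ℓ ≠ 0) (p : EuclideanSpace ℝ (Fin 3)) :
    mFourierCoeff (FunctionSpaces.EuclideanSpace.complexify ∘ fun x : UnitAddTorus (Fin 3) => (UnitAddTorus.mFourier ℓ x).re • p) ℓ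
      = (2 : ℂ)⁻¹ • FunctionSpaces.EuclideanSpace.complexify p := by
  have hne : ℓ ≠ -ℓ := by
    intro h
    apply hℓ
    funext i
    have hi := congrArg (fun v => v i) h
    simp only [Pi.neg_apply] at hi
    have : ℓ i = 0 := by omega
    simpa using this
  rw [RealisedQuasiStaticCellLaw.singleMode_eq_realTrigPoly, FunctionSpaces.Torus.mFourierCoeff_realTrigPoly_singleton,
    if_pos rfl, if_neg hne, FunctionSpaces.EuclideanSpace.conjVec_zero, add_zero]

/-- Components of the datum coefficient: real part `pⱼ/2`, imaginary part `0`. [folklore] -/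
theorem mFourierCoeff_singleMode_self_apply (hℓ : ℓ ≠ 0) (p : EuclideanSpace ℝ (Fin 3)) (j : Fin 3) :
    mFourierCoeff (FunctionSpaces.EuclideanSpace.complexify ∘ fun x : UnitAddTorus (Fin 3) => (UnitAddTorus.mFourier ℓ x).re • p) ℓ j
      = ((p j / 2 : ℝ) : ℂ) := by
  rw [mFourierCoeff_singleMode_self hℓ p, PiLp.smul_apply, FunctionSpaces.EuclideanSpace.complexify_apply, smul_eq_mul]
  push_cast
  ring

/-- The complexified real test vector `q`. -/
def testVec (q : Fin 3 → ℝ) : EuclideanSpace ℂ (Fin 3) := WithLp.toLp 2 fun j => (q j : ℂ)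

/-- A transversal real test vector stays transversal after complexification. [folklore] -/
theorem testVec_transversal {q : Fin 3 → ℝ} (hq : ∑ j, (ℓ j : ℝ) * q j = 0) : ∑ j, (ℓ j : ℂ) * testVec q j = 0 := by
  simp only [testVec, PiLp.toLp_apply]
  exact_mod_cast hq

/-- Real part of the pairing with a real test vector. [folklore] -/
theorem re_inner_testVec (c : EuclideanSpace ℂ (Fin 3)) (q : Fin 3 → ℝ) :
    (⟪c, testVec q⟫_ℂ).re = ∑ j, q j * (c j).re := by
  rw [PiLp.inner_apply, Complex.re_sum]
  refine Finset.sum_congr rfl fun j _ => ?_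
  simp [testVec]

/-- Imaginary part of the pairing with a real test vector. [folklore] -/
theorem im_inner_testVec (c : EuclideanSpace ℂ (Fin 3)) (q : Fin 3 → ℝ) :
    (⟪c, testVec q⟫_ℂ).im = -∑ j, q j * (c j).im := by
  rw [PiLp.inner_apply, Complex.im_sum, ← Finset.sum_neg_distrib]
  refine Finset.sum_congr rfl fun j _ => ?_
  simp [testVec]

/-- The symbol matrix on a complexified real vector is the complexification of a real vector. [folklore] -/
theorem symbT_testVec (𝔹 : Torus.Visc4 (Fin 3)) (ℓ : Fin 3 → ℤ) (q : Fin 3 → ℝ) :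
    Torus.symbT 𝔹 ℓ (testVec q) = testVec fun j => ∑ i, ∑ a, ∑ b, 𝔹 i a j b * (ℓ a : ℝ) * (ℓ b : ℝ) * q i := by
  ext j
  rw [Torus.symbT_apply]
  simp only [testVec, PiLp.toLp_apply]
  push_cast
  rfl

/-- **The mode identity of the carrier-free problem, real form.**  For every real transversal test vector `q` (`Σ ℓⱼqⱼ = 0`) and a.e.
`t ∈ (0,T')`: `Σⱼ qⱼ Re 𝓕(v t)(ℓ)ⱼ = Σⱼ qⱼ (pⱼ/2) − ∫₀ᵗ 4π² Σⱼ (Σ_{iab} 𝔹 i a j b ℓ_a ℓ_b qᵢ) Re 𝓕(v τ)(ℓ)ⱼ dτ` and the same for the imaginary parts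
with datum `0` (from `IsWeakTensorPassiveVectorOn.ae_inner_mFourierCoeff_eq`; the carrier terms vanish). [folklore] -/
theorem effective_mode_identity_re_im (hℓ : ℓ ≠ 0)
    (hv : Torus.IsWeakTensorPassiveVectorOn 0 T' 𝔹 (fun _ _ => 0) (fun x => (UnitAddTorus.mFourier ℓ x).re • p) v)
    {q : Fin 3 → ℝ} (hq : ∑ j, (ℓ j : ℝ) * q j = 0) :
    ∀ᵐ t ∂(volume.restrict (Ioo 0 T')),
      (∑ j, q j * (mFourierCoeff (FunctionSpaces.EuclideanSpace.complexify ∘ v t) ℓ j).re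
        = ∑ j, q j * (p j / 2) - ∫ τ in (0:ℝ)..t, 4 * Real.pi ^ 2 *
            ∑ j, (∑ i, ∑ a, ∑ b, 𝔹 i a j b * (ℓ a : ℝ) * (ℓ b : ℝ) * q i) *
              (mFourierCoeff (FunctionSpaces.EuclideanSpace.complexify ∘ v τ) ℓ j).re) ∧
      (∑ j, q j * (mFourierCoeff (FunctionSpaces.EuclideanSpace.complexify ∘ v t) ℓ j).im
        = - ∫ τ in (0:ℝ)..t, 4 * Real.pi ^ 2 *
            ∑ j, (∑ i, ∑ a, ∑ b, 𝔹 i a j b * (ℓ a : ℝ) * (ℓ b : ℝ) * q i) *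
              (mFourierCoeff (FunctionSpaces.EuclideanSpace.complexify ∘ v τ) ℓ j).im) := by
  have hw₀i : Integrable (fun x : UnitAddTorus (Fin 3) => (UnitAddTorus.mFourier ℓ x).re • p) volume :=
    (RealisedQuasiStaticCellLaw.memLp_two_of_memSobolev_one_complexify
      (RealisedQuasiStaticCellLaw.memSobolev_one_singleMode ℓ p)).integrable one_le_two
  have hid := hv.ae_inner_mFourierCoeff_eq hw₀i ℓ (testVec_transversal hq)
  have hc : IntegrableOn (fun t => mFourierCoeff (FunctionSpaces.EuclideanSpace.complexify ∘ v t) ℓ) (Ioo 0 T') volume :=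
    hv.integrableOn_mFourierCoeff ℓ
  filter_upwards [hid, ae_restrict_mem measurableSet_Ioo] with t ht htT
  set N : Fin 3 → ℝ := fun j => ∑ i, ∑ a, ∑ b, 𝔹 i a j b * (ℓ a : ℝ) * (ℓ b : ℝ) * q i with hN
  -- the carrier terms vanish and the integrand is `F τ = -4π² ⟪ĉ(τ), T q⟫`
  have hzero : ∀ (τ : ℝ) (j : Fin 3),
      mFourierCoeff (FunctionSpaces.EuclideanSpace.complexify ∘ fun x => (fun (_ : ℝ) (_ : UnitAddTorus (Fin 3)) =>
        (0 : EuclideanSpace ℝ (Fin 3))) τ x j • v τ x) ℓ = 0 := by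
    intro τ j
    rw [FunctionSpaces.Torus.mFourierCoeff_eq_integral_volume]
    simp
  set F : ℝ → ℂ := fun τ => ((-(4 * Real.pi ^ 2 : ℝ) : ℂ)) *
      ⟪mFourierCoeff (FunctionSpaces.EuclideanSpace.complexify ∘ v τ) ℓ, Torus.symbT 𝔹 ℓ (testVec q)⟫_ℂ with hF
  have hintegrand : ∫ τ in Ioc 0 t,
      (((-(4 * Real.pi ^ 2 : ℝ) : ℂ)) * ⟪mFourierCoeff (FunctionSpaces.EuclideanSpace.complexify ∘ v τ) ℓ, Torus.symbT 𝔹 ℓ (testVec q)⟫_ℂ +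
        ((∑ j, (2 * Real.pi * Complex.I * (ℓ j)) *
            ⟪mFourierCoeff (FunctionSpaces.EuclideanSpace.complexify ∘ fun x => (fun (_ : ℝ) (_ : UnitAddTorus (Fin 3)) =>
              (0 : EuclideanSpace ℝ (Fin 3))) τ x j • v τ x) ℓ, testVec q⟫_ℂ) +
          ((0:ℝ) : ℂ) * ∑ j, (2 * Real.pi * Complex.I * (ℓ j)) *
            ⟪mFourierCoeff (FunctionSpaces.EuclideanSpace.complexify ∘ fun x => v τ x j • (fun (_ : ℝ) (_ : UnitAddTorus (Fin 3)) =>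
              (0 : EuclideanSpace ℝ (Fin 3))) τ x) ℓ, testVec q⟫_ℂ)) = ∫ τ in Ioc 0 t, F τ := by
    refine setIntegral_congr_fun measurableSet_Ioc fun τ _ => ?_
    simp only [hF, hzero τ, inner_zero_left, mul_zero, Finset.sum_const_zero, add_zero, Complex.ofReal_zero, zero_mul]
  rw [hintegrand] at ht
  -- integrability of `F` on `(0, t]` and its real / imaginary parts
  have hFi : IntegrableOn F (Ioc 0 t) volume :=
    ((hc.mono_set (Ioc_subset_Ioo_right htT.2)).inner_const _).const_mul _
  have hFre : ∀ τ, (F τ).re = -(4 * Real.pi ^ 2 *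
      ∑ j, N j * (mFourierCoeff (FunctionSpaces.EuclideanSpace.complexify ∘ v τ) ℓ j).re) := by
    intro τ
    rw [hF]
    simp only [symbT_testVec, ← hN]
    rw [neg_mul, Complex.neg_re, Complex.re_ofReal_mul, re_inner_testVec]
  have hFim : ∀ τ, (F τ).im = 4 * Real.pi ^ 2 *
      ∑ j, N j * (mFourierCoeff (FunctionSpaces.EuclideanSpace.complexify ∘ v τ) ℓ j).im := by
    intro τ
    rw [hF]
    simp only [symbT_testVec, ← hN]
    rw [neg_mul, Complex.neg_im, Complex.im_ofReal_mul, im_inner_testVec]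
    ring
  have hre_int : (∫ τ in Ioc 0 t, F τ).re = ∫ τ in Ioc 0 t, (F τ).re := by
    have h := integral_re hFi
    simp only [RCLike.re_to_complex] at h
    exact h.symm
  have him_int : (∫ τ in Ioc 0 t, F τ).im = ∫ τ in Ioc 0 t, (F τ).im := by
    have h := integral_im hFi
    simp only [RCLike.im_to_complex] at h
    exact h.symm
  have hre := congrArg Complex.re ht
  have him := congrArg Complex.im ht
  rw [Complex.add_re, hre_int, re_inner_testVec, re_inner_testVec] at hre
  rw [Complex.add_im, him_int, im_inner_testVec, im_inner_testVec] at him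
  simp only [hFre, mFourierCoeff_singleMode_self_apply hℓ, Complex.ofReal_re] at hre
  simp only [hFim, mFourierCoeff_singleMode_self_apply hℓ, Complex.ofReal_im, mul_zero,
    Finset.sum_const_zero, neg_zero, zero_add] at him
  rw [intervalIntegral.integral_of_le htT.1.le, intervalIntegral.integral_of_le htT.1.le]
  constructor
  · rw [hre, integral_neg, sub_eq_add_neg]
  · linarith


/-- Transversality of the slow mode, real and imaginary parts: `Σ ℓⱼ Re ĉⱼ(τ) = 0 = Σ ℓⱼ Im ĉⱼ(τ)` for a.e. `τ` (weakly divergence-free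
slices, `IsWeaklyDivFree.sum_mul_mFourierCoeff_eq_zero`). [folklore] -/
theorem effective_mode_transversal {A T' : ℝ} {𝔹 : Torus.Visc4 (Fin 3)} {b : ℝ → VF} {w₀ : VF} {v : ℝ → VF}
    (hv : Torus.IsWeakTensorPassiveVectorOn A T' 𝔹 b w₀ v) (ℓ : Fin 3 → ℤ) :
    ∀ᵐ τ ∂(volume.restrict (Ioo 0 T')),
      (∑ j, (ℓ j : ℝ) * (mFourierCoeff (FunctionSpaces.EuclideanSpace.complexify ∘ v τ) ℓ j).re = 0) ∧
      (∑ j, (ℓ j : ℝ) * (mFourierCoeff (FunctionSpaces.EuclideanSpace.complexify ∘ v τ) ℓ j).im = 0) := by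
  filter_upwards [hv.ae_memLp_two, hv.ae_isWeaklyDivFree] with τ h2 hdiv
  have h := hdiv.sum_mul_mFourierCoeff_eq_zero h2 ℓ
  have hre := congrArg Complex.re h
  have him := congrArg Complex.im h
  rw [Complex.re_sum, Complex.zero_re] at hre
  rw [Complex.im_sum, Complex.zero_im] at him
  constructor
  · rw [← hre]
    exact Finset.sum_congr rfl fun j _ => by simp [Complex.mul_re]
  · rw [← him]
    exact Finset.sum_congr rfl fun j _ => by simp [Complex.mul_im]

/-- **THE SLOW MODE OF THE EFFECTIVE SOLUTION IS EXPLICIT.**  For every constant tensor `𝔹`, `ℓ ≠ 0`, `p ⊥ ℓ` and every weak solution `v` of the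
carrier-free problem `∂ₜv = 𝓛_𝔹 v + ∇π`, `∇·v = 0` from `Re e_ℓ·p` on `(0,T')`: for a.e. `t ∈ (0,T')`,
`𝓕(v t)(ℓ)ⱼ = (e^{−tḠ} (p/2))ⱼ` with `Ḡ = effGen 𝔹 ℓ = 4π² P_ℓ Σ(𝔹,ℓ) P_ℓ`. [folklore] -/
theorem effective_mFourierCoeff_eq (hℓ : ℓ ≠ 0) (hpℓ : ⟪p, Torus.latticeVec ℓ⟫_ℝ = 0)
    (hv : Torus.IsWeakTensorPassiveVectorOn 0 T' 𝔹 (fun _ _ => 0) (fun x => (UnitAddTorus.mFourier ℓ x).re • p) v) :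
    ∀ᵐ t ∂(volume.restrict (Ioo 0 T')), ∀ j,
      mFourierCoeff (FunctionSpaces.EuclideanSpace.complexify ∘ v t) ℓ j =
        (((NormedSpace.exp (-(t • effGen 𝔹 ℓ))).mulVec (fun i => p i / 2) j : ℝ) : ℂ) := by
  set X : ℝ → Fin 3 → ℝ := fun t j => (mFourierCoeff (FunctionSpaces.EuclideanSpace.complexify ∘ v t) ℓ j).re with hX
  set Y : ℝ → Fin 3 → ℝ := fun t j => (mFourierCoeff (FunctionSpaces.EuclideanSpace.complexify ∘ v t) ℓ j).im with hY
  have hc : IntegrableOn (fun t => mFourierCoeff (FunctionSpaces.EuclideanSpace.complexify ∘ v t) ℓ) (Ioo 0 T') volume :=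
    hv.integrableOn_mFourierCoeff ℓ
  have hcj : ∀ j, IntegrableOn (fun t => mFourierCoeff (FunctionSpaces.EuclideanSpace.complexify ∘ v t) ℓ j) (Ioo 0 T') volume :=
    fun j => (EuclideanSpace.proj (𝕜 := ℂ) j).integrable_comp hc
  have hXi : ∀ j, IntegrableOn (fun τ => X τ j) (Ioo 0 T') volume := fun j => (hcj j).re
  have hYi : ∀ j, IntegrableOn (fun τ => Y τ j) (Ioo 0 T') volume := fun j => (hcj j).im
  -- transversality
  have htr := effective_mode_transversal hv ℓ
  have hpℓ' : ∑ j, (ℓ j : ℝ) * (p j / 2) = 0 := by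
    have h : ∑ j, p j * (ℓ j : ℝ) = 0 := by
      have e : ⟪p, Torus.latticeVec ℓ⟫_ℝ = ∑ j, p j * (ℓ j : ℝ) := by
        rw [real_inner_comm, PiLp.inner_apply]
        exact Finset.sum_congr rfl fun j _ => by simp [Torus.latticeVec_apply]
      rw [← e]; exact hpℓ
    have : ∑ j, (ℓ j : ℝ) * (p j / 2) = (∑ j, p j * (ℓ j : ℝ)) / 2 := by
      rw [Finset.sum_div]; exact Finset.sum_congr rfl fun j _ => by ring
    rw [this, h, zero_div]
  -- the projected identities for the three columns of `P_ℓ`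
  have hid := fun i : Fin 3 => effective_mode_identity_re_im hℓ hv (sum_kvec_mul_projPerp_col hℓ i)
  have hall := (ae_all_iff (μ := volume.restrict (Ioo 0 T'))).2 hid
  have hXeq : ∀ᵐ t ∂(volume.restrict (Ioo 0 T')), ∀ i, X t i = p i / 2 - ∫ τ in (0:ℝ)..t, (effGen 𝔹 ℓ).mulVec (X τ) i := by
    refine integral_eq_effGen_of_projected (𝔹 := 𝔹) (X₀ := fun i => p i / 2) ?_ hpℓ' ?_
    · filter_upwards [htr] with τ hτ; exact hτ.1
    · filter_upwards [hall] with t ht i; exact (ht i).1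
  have hYeq : ∀ᵐ t ∂(volume.restrict (Ioo 0 T')), ∀ i, Y t i = (0 : Fin 3 → ℝ) i - ∫ τ in (0:ℝ)..t, (effGen 𝔹 ℓ).mulVec (Y τ) i := by
    refine integral_eq_effGen_of_projected (𝔹 := 𝔹) (X₀ := fun _ => 0) ?_ (by simp) ?_
    · filter_upwards [htr] with τ hτ; exact hτ.2
    · filter_upwards [hall] with t ht i
      simp only [mul_zero, Finset.sum_const_zero, zero_sub]
      exact (ht i).2
  have hXexp := ae_eq_exp_neg_smul_mulVec (effGen 𝔹 ℓ) (fun i => p i / 2) hXi hXeq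
  have hYexp := ae_eq_exp_neg_smul_mulVec (effGen 𝔹 ℓ) (fun _ => (0:ℝ)) hYi hYeq
  filter_upwards [hXexp, hYexp] with t hXt hYt j
  have hY0 : Y t j = 0 := by
    rw [hYt]
    simp [Matrix.mulVec, dotProduct]
  apply Complex.ext
  · rw [Complex.ofReal_re]
    exact congrFun hXt j
  · rw [Complex.ofReal_im]
    exact hY0

/-- **The slow mode in the registered `modeCoeff` currency**: `modeCoeff ℓ (v t) j = ((e^{−tḠ} p)ⱼ / 2 : ℂ)` for a.e. `t ∈ (0,T')`. [folklore] -/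
theorem effective_modeCoeff_eq (hℓ : ℓ ≠ 0) (hpℓ : ⟪p, Torus.latticeVec ℓ⟫_ℝ = 0)
    (hv : Torus.IsWeakTensorPassiveVectorOn 0 T' 𝔹 (fun _ _ => 0) (fun x => (UnitAddTorus.mFourier ℓ x).re • p) v) :
    ∀ᵐ t ∂(volume.restrict (Ioo 0 T')), ∀ j,
      modeCoeff ℓ (v t) j = (((NormedSpace.exp (-(t • effGen 𝔹 ℓ))).mulVec (fun i => p i / 2) j : ℝ) : ℂ) := by
  filter_upwards [effective_mFourierCoeff_eq hℓ hpℓ hv, hv.ae_memLp_two] with t ht ht2 j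
  rw [modeCoeff_eq (ht2.integrable one_le_two)]
  exact ht j

end Effective

end Summit.AnomalousDissipation.AnomalousDissipation.Theorems.SolenoidalFractalHomogenisation.LagrangianStep

end
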